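import Mathlib
import HarnessLib
import Summits.HubbardSuperconductivity.HubbardSuperconductivity.Theorems.KLProgrammeC4aJacobianPolarJetsThree
import Summits.HubbardSuperconductivity.HubbardSuperconductivity.Theorems.KLProgrammeC4aJacobianFrameJets

/-!
# Route `KLProgramme` — crux C4a, named input (i) «Jacobian jets» AT THE FRAME, ORDER 3 with an explicit constant
# `‖∂_ϑ³ levelChartJac μ K (ρ, ·)‖ ≤ klJacG3 Dt_min A A₃ A₄` — affine in the frame's order-4 size `A₄` (which carries the `16ⁿ` allowance)

Cell `gate-hubbard-kl`, lane hubbard-kl-c4a-1 (g2); helper for stub (C) of `KLRegimeEngineV17F2` (stmt-HubbardSuperconductivity-20437; memo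
HOME/hubbard-kl-c4a-1/C4A-PLAN.md §12.2; plan g17 KL STATUS l.3124 (1)).  The order-3 companion of `…C4aJacobianFrameJets` (orders 0–2): feeds
`…C4aJacobianPolarJetsThree.abs_deriv_three_polarJac_le` the frame's sizes (`E₁ = 4+2A`, `E₂ = 4+4A`, `E₃ = 4+8A₃`, `E₄ = 4+16A₄`
(`norm_fderiv_four_frameShift_le`), `ρ₀ = Dt_min − 2A`, `U₀ = π√2`, `R₁, R₂` of `…FrameJets`, `R₃` from `abs_deriv_three_le_of_isRoot`).

* `klJacR3`, `klJacΔ3`, `klJacG3` (explicit constants); `abs_deriv_three_levelChartJac_le`;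
* `norm_iteratedDeriv_levelChartJac_le_three` — the `hJjet` shape of `norm_iteratedDeriv_tubeTadpole_le` for `N = 3` with the table
  `klJacGTable Dt A A₃ A₄ i` (orders 0–2 = `klJacG`, order 3 = `klJacG3`).  Order 4 (needs `D⁗` and the order-5 frame size) is g3's.

Pure calculus on the tree's objects; nothing is asserted about the Hubbard model.  References: BGM 2006 §2.4 Lemma 2.1 (2.40)
[cite: BenfattoGiulianiMastropietro2006].
-/

noncomputable section

namespace Summit.HubbardSuperconductivity.HubbardSuperconductivity.Theorems.C4a

set_option linter.dupNamespace false -- summit = problem name (single-conjunct summit), D-0017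
set_option maxSynthPendingDepth 4 -- nested operator-norm instances (fourth Fréchet derivatives)

open Real Set
open Literature.MathematicalPhysics.QuantumLattice Literature.MathematicalPhysics.QuantumLattice.BandSectorCounting
open Summit.HubbardSuperconductivity.HubbardSuperconductivity.Theorems.DispersionFlow
open Summit.HubbardSuperconductivity.HubbardSuperconductivity.Theorems.KLRegimeSplit
open Summit.HubbardSuperconductivity.HubbardSuperconductivity.Theorems.PerturbedFermiCurve

/-- `R₃(A, A₃)` — the uniform third-derivative bound of the frame's radius (`abs_deriv_three_le_of_isRoot` at `R₁ = klJacR1`, `R₂ = klJacR2`,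
`κ₁ = 2A`, `κ₂ = 4A`, `κ₃ = 8A₃`). -/
def klJacR3 (Dt A A₃ : ℝ) : ℝ :=
  ((4 + 8 * A₃) * (klJacR1 Dt A + π * Real.sqrt 2) ^ 3 +
      3 * (4 + 4 * A) * (klJacR1 Dt A + π * Real.sqrt 2) * (klJacR2 Dt A + 2 * klJacR1 Dt A + π * Real.sqrt 2) +
      (4 + 2 * A) * (3 * klJacR2 Dt A + 3 * klJacR1 Dt A + π * Real.sqrt 2)) / (Dt - 2 * A)

/-- `Δ₃ = E₄K₁³ + 3E₃K₁K₂ + 3E₃K₁² + E₂K₃ + 3E₂K₂ + 3E₂K₁ + E₁` at the frame's sizes (`E₄ = 4 + 16A₄`). -/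
def klJacΔ3 (Dt A A₃ A₄ : ℝ) : ℝ :=
  (4 + 16 * A₄) * (klJacR1 Dt A + π * Real.sqrt 2) ^ 3 +
    3 * ((4 + 8 * A₃) * (klJacR1 Dt A + π * Real.sqrt 2) * (klJacR2 Dt A + 2 * klJacR1 Dt A + π * Real.sqrt 2)) +
    3 * ((4 + 8 * A₃) * (klJacR1 Dt A + π * Real.sqrt 2) ^ 2) +
    (4 + 4 * A) * (klJacR3 Dt A A₃ + 3 * klJacR2 Dt A + 3 * klJacR1 Dt A + π * Real.sqrt 2) +
    3 * ((4 + 4 * A) * (klJacR2 Dt A + 2 * klJacR1 Dt A + π * Real.sqrt 2)) +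
    3 * ((4 + 4 * A) * (klJacR1 Dt A + π * Real.sqrt 2)) + (4 + 2 * A)

/-- **The order-3 Jacobian-jet constant** `G₃ = R₃/ρ₀ + 3R₂Δ₁/ρ₀² + 3R₁Δ₂/ρ₀² + 6R₁Δ₁²/ρ₀³ + π√2·(Δ₃/ρ₀² + 6Δ₁Δ₂/ρ₀³ + 6Δ₁³/ρ₀⁴)`. -/
def klJacG3 (Dt A A₃ A₄ : ℝ) : ℝ :=
  klJacR3 Dt A A₃ / (Dt - 2 * A) + 3 * (klJacR2 Dt A * klJacΔ1 Dt A) / (Dt - 2 * A) ^ 2 +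
    3 * (klJacR1 Dt A * klJacΔ2 Dt A A₃) / (Dt - 2 * A) ^ 2 + 6 * (klJacR1 Dt A * klJacΔ1 Dt A ^ 2) / (Dt - 2 * A) ^ 3 +
    π * Real.sqrt 2 * klJacΔ3 Dt A A₃ A₄ / (Dt - 2 * A) ^ 2 +
    6 * (π * Real.sqrt 2 * (klJacΔ1 Dt A * klJacΔ2 Dt A A₃)) / (Dt - 2 * A) ^ 3 +
    6 * (π * Real.sqrt 2 * klJacΔ1 Dt A ^ 3) / (Dt - 2 * A) ^ 4

/-- **The Jacobian-jet table to order 3**: orders `0–2` from `klJacG`, order `≥ 3` from `klJacG3`. -/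
def klJacGTable (Dt A A₃ A₄ : ℝ) (i : ℕ) : ℝ :=
  if i ≤ 2 then klJacG Dt A A₃ i else klJacG3 Dt A A₃ A₄

section Frame

variable {a b : ℝ} (B : BandBounds a b) {K : TrigPolyC4v} {A : ℝ}
  (hA : ∀ p : Momentum, ∀ j ≤ 2, ‖iteratedFDeriv ℝ j (frameShift K) p‖ ≤ A) (hADt : 2 * A < B.Dtmin)
  {μ ρ : ℝ} (hlo : a < μ + ρ - A) (hhi : μ + ρ + A < b)
include B hA hADt hlo hhi

/-- **Order 3 at the frame**: `|∂_ϑ³ levelChartJac μ K (ρ, ϑ)| ≤ klJacG3 B.Dtmin A A₃ A₄`. -/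
theorem abs_deriv_three_levelChartJac_le {A₃ A₄ : ℝ} (hA₃ : ∀ p : Momentum, ‖iteratedFDeriv ℝ 3 (frameShift K) p‖ ≤ A₃)
    (hA₄ : ∀ p : Momentum, ‖iteratedFDeriv ℝ 4 (frameShift K) p‖ ≤ A₄) (ϑ : ℝ) :
    |deriv (deriv (deriv (fun s : ℝ => levelChartJac μ K (ρ, s)))) ϑ| ≤ klJacG3 B.Dtmin A A₃ A₄ := by
  obtain ⟨he, hu, hρ, hE₁, hE₂, hU₀, hR₁, hR₂⟩ := polar_data B hA hADt hlo hhi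
  obtain ⟨hC, hδ, hκ, hκ₂, hroot⟩ := frame_band_data B hA (μ := μ + ρ) hlo.le hhi.le
  have hκ₃ : ∀ k : Fin 2 → ℝ, (∀ i, |k i| ≤ π) →
      ‖fderiv ℝ (fderiv ℝ (fderiv ℝ (fun p : Fin 2 → ℝ => -K.eval p))) k‖ ≤ 8 * A₃ := fun k _ => norm_fderiv_three_frameShift_le hA₃ k
  have hκ₄ : ∀ k : Fin 2 → ℝ, (∀ i, |k i| ≤ π) →
      ‖fderiv ℝ (fderiv ℝ (fderiv ℝ (fderiv ℝ (fun p : Fin 2 → ℝ => -K.eval p)))) k‖ ≤ 16 * A₄ :=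
    fun k _ => norm_fderiv_four_frameShift_le hA₄ k
  have hE₃ : ∀ ϑ, ‖fderiv ℝ (fderiv ℝ (fderiv ℝ (fun k : Fin 2 → ℝ => sqDispersion k + (fun k : Fin 2 → ℝ => -K.eval k) k)))
      (perturbedFermiRadius (fun k : Fin 2 → ℝ => -K.eval k) (μ + ρ) ϑ • dir ϑ)‖ ≤ 4 + 8 * A₃ :=
    fun ϑ => norm_fderiv_three_pertBand_le hC hroot hκ₃ ϑ
  have hE₄ : ∀ ϑ, ‖fderiv ℝ (fderiv ℝ (fderiv ℝ (fderiv ℝ (fun k : Fin 2 → ℝ => sqDispersion k + (fun k : Fin 2 → ℝ => -K.eval k) k))))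
      (perturbedFermiRadius (fun k : Fin 2 → ℝ => -K.eval k) (μ + ρ) ϑ • dir ϑ)‖ ≤ 4 + 16 * A₄ :=
    fun ϑ => norm_fderiv_four_pertBand_le hC hroot hκ₄ ϑ
  have hR₃ : ∀ ϑ, |deriv (deriv (deriv (perturbedFermiRadius (fun k : Fin 2 → ℝ => -K.eval k) (μ + ρ)))) ϑ| ≤
      klJacR3 B.Dtmin A A₃ := fun ϑ =>
    abs_deriv_three_le_of_isRoot B hC hδ hlo.le hhi.le hκ hADt hroot hκ₂ hκ₃ (hR₁ ϑ) (hR₂ ϑ)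
  rw [levelChartJac_curve_eq_polarJac B hA hADt hlo hhi]
  have h := abs_deriv_three_polarJac_le he hu (sub_pos.2 hADt) hρ hE₁ hE₂ hE₃ hE₄ hU₀ hR₁ hR₂ hR₃ ϑ
  simpa [klJacG3, klJacΔ1, klJacΔ2, klJacΔ3, mul_div_assoc] using h

/-- **Jacobian jets of orders `≤ 3` on the tube** (the `hJjet` of `norm_iteratedDeriv_tubeTadpole_le` at `N = 3`):
`∀ i ≤ 3, ∀ s, ‖iteratedDeriv i (fun s => levelChartJac μ K (ρ, s)) s‖ ≤ klJacGTable B.Dtmin A A₃ A₄ i`. -/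
theorem norm_iteratedDeriv_levelChartJac_le_three {A₃ A₄ : ℝ} (hA₃ : ∀ p : Momentum, ‖iteratedFDeriv ℝ 3 (frameShift K) p‖ ≤ A₃)
    (hA₄ : ∀ p : Momentum, ‖iteratedFDeriv ℝ 4 (frameShift K) p‖ ≤ A₄) {i : ℕ} (hi : i ≤ 3) (s : ℝ) :
    ‖iteratedDeriv i (fun s : ℝ => levelChartJac μ K (ρ, s)) s‖ ≤ klJacGTable B.Dtmin A A₃ A₄ i := by
  by_cases h2 : i ≤ 2
  · rw [klJacGTable, if_pos h2]
    exact norm_iteratedDeriv_levelChartJac_le_two B hA hADt hlo hhi hA₃ h2 s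
  · have hi3 : i = 3 := by omega
    subst hi3
    rw [klJacGTable, if_neg h2, Real.norm_eq_abs, iteratedDeriv_succ, iteratedDeriv_succ, iteratedDeriv_one]
    exact abs_deriv_three_levelChartJac_le B hA hADt hlo hhi hA₃ hA₄ s

end Frame

end Summit.HubbardSuperconductivity.HubbardSuperconductivity.Theorems.C4a
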